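import Literature.Computability.AlgebraicComplexity.BI17FundamentalInvariantTensors
import Mathlib.Algebra.MvPolynomial.Funext
import HarnessLib

/-!
# Consistency guards for "almost all tensors" statements (BI 2017 §4.1, `IsZariskiGenericTensor`)

Sibling proof file of `Literature/Computability/AlgebraicComplexity/BI17FundamentalInvariantTensors.lean`
(cell `val-lit`, DAG row BI2017-B): the tensor analogues of `IsZariskiGeneric.and` /
`IsZariskiGeneric.exists_form` (forms, `BI17NonNormalOrbitClosuresProofs.lean`,
`BI17QuadraticPolystableProofs.lean`). For every typed statement of the shape
`IsZariskiGenericTensor P` ("almost all `w ∈ ⊗³ k^ι` satisfy `P`", BI 2017 §4.1) they certify that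
the property is satisfied by SOME tensor, and that two generic properties are jointly satisfiable —
the vacuity check referees ask for. Everything PROVED; no definitions, no facts; nothing here bears
on `VP` versus `VNP`.
-/

noncomputable section

open MvPolynomial

namespace Literature.Computability.AlgebraicComplexity

variable {ι k : Type*} [Field k]

/-- Zariski-generic tensor properties are closed under conjunction (product of the test
polynomials). [cite: BurgisserIkenmeyer2017, §4.1 ("almost all")] -/
theorem IsZariskiGenericTensor.and {P Q : (ι → ι → ι → k) → Prop} (hP : IsZariskiGenericTensor P)
    (hQ : IsZariskiGenericTensor Q) : IsZariskiGenericTensor fun w => P w ∧ Q w := by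
  obtain ⟨F, hF0, hF⟩ := hP
  obtain ⟨G, hG0, hG⟩ := hQ
  refine ⟨F * G, mul_ne_zero hF0 hG0, fun w hFG => ?_⟩
  rw [map_mul] at hFG
  exact ⟨hF w (left_ne_zero_of_mul hFG), hG w (right_ne_zero_of_mul hFG)⟩

/-- **A Zariski-generic property of tensors holds for SOME tensor** (over an infinite field a
non-zero polynomial in the `|ι|³` coordinates has a non-zero value; every coordinate vector is
`tensorPt` of a tensor). [cite: BurgisserIkenmeyer2017, §4.1 ("almost all")] -/
theorem IsZariskiGenericTensor.exists_tensor [Infinite k] {P : (ι → ι → ι → k) → Prop}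
    (h : IsZariskiGenericTensor P) : ∃ w : ι → ι → ι → k, P w := by
  obtain ⟨F, hF0, hF⟩ := h
  have hv : ∃ v : ι × ι × ι → k, aeval v F ≠ 0 := by
    by_contra hall
    push Not at hall
    exact hF0 (MvPolynomial.funext fun v => by rw [map_zero, ← coe_aeval_eq_eval]; exact hall v)
  obtain ⟨v, hv⟩ := hv
  refine ⟨fun a b c => v (a, b, c), hF _ ?_⟩
  have : tensorPt (fun a b c => v (a, b, c)) = v := by
    funext p
    rfl
  rwa [this]

/-- No property failing for every tensor is Zariski-generic.
[cite: BurgisserIkenmeyer2017, §4.1 ("almost all")] -/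
theorem not_isZariskiGenericTensor_false [Infinite k] :
    ¬ IsZariskiGenericTensor (fun _ : ι → ι → ι → k => False) := by
  intro h
  obtain ⟨_, hfalse⟩ := IsZariskiGenericTensor.exists_tensor h
  exact hfalse

end Literature.Computability.AlgebraicComplexity

end
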